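import Summits.QuantumFields.BalabanUV.Beta.WilsonDivergenceContact

/-!
# `BalabanUV.Beta.D1BFx.ColumnGaugeGenerator` — road «BF-x», binder row D1, PART 24 (chart of record (α′), an2 R-D1-g44-2):
# THE ROTATION GENERATOR OF A COLUMN GAUGE — the `χ`-weighted superposition of the diagonal site generators is ONE diagonal kernel,
# and superposing slot Ward letters of `conjV` shape gives the commutator with it (letters (b)(c)(d) of `COLUMN-GAUGE-INSTANCE-SPEC-g23` v0.1)

HONEST DEPENDENCY (cell records, verbatim): «continuum YM on T⁴ ⇐ BetaPertH ∧ nine spine estimates (0/9 proved); BetaPertH ⇐ (D1) ∧ (D4) ∧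
CAP+tail; G-an2-4 gates asym, D1 and NE2/3/4.»  HONEST FRAMING (cell contract, verbatim): «discharging `BetaPertH` makes Bałaban's UV stability
UNCONDITIONAL — a real constructive-QFT result; it is NOT the continuum limit and NOT the Clay problem.»  THIS MODULE DISCHARGES NO binder of
row D1 and NO estimate of Bałaban's: [folklore] single-point `tsum` bookkeeping over an1's `legInd`∕`legSite`, lit-balaban's `wsum`, `diagK`,
`conjV`.  No `def`, no `def … : Prop`, nothing cited, 0 sorry.  NOT D1, NOT BetaPertH, NOT continuum, NOT Clay.

ABSOLUTE RULE (cell charter, verbatim): «No internally-minted statement may enter as a cited fact. Every hypothesis is either kernel-proved in this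
package or a verbatim quotation of a PUBLISHED theorem with page reference.»

WHERE THIS SITS.  leaf-01 g29's `DressedVertexSplit.vertexOfK_coDressKBmAt_eq_sub` writes the bm-dressed chain-rule vertex as
`V^{bm} μ y = V μ y − wsum χ_{μ,y} (divV S)`; an1's rooted slot Ward letters have the shape `divV S u = conjV 𝕄 (diagK (legInd ρ u))`
(`AveragingWardRootedStencils.divV_vhSAt_eq_conjV` for the averaging table).  §1 `wsum_diagK_legInd`: `wsum χ (u ↦ diagK (legInd ρ u)) =
diagK (z b ↦ χ (legSite ρ z b))` — for each leg exactly one varied site contributes (no summability needed).  §2 `wsum_conjV_diagK_legInd`: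
`wsum χ (u ↦ conjV M (diagK (legInd ρ u))) = conjV M (diagK (z b ↦ χ (legSite ρ z b)))` — so a family obeying the letter for every `u` has
`wsum χ (divV S) = 𝕄∘Λ − Λ∘𝕄` with the ROTATION GENERATOR `Λ := diagK (χ ∘ legSite ρ)` (`wsum_divV_eq_conjV_of_letters`), i.e.
`V^{bm} = V + (Λ∘𝕄 − 𝕄∘Λ)` — exactly the `G` of `ColumnGaugeInvariance.hessKer_columnGauge_of_relInv`; and `Λ` commutes with the axial
coordinate projector (`DiagonalContact.comp_axEc_diagK_comm`, restated as `comp_generator_axEc_comm`).  Which families obey the letter, and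
with which `𝕄`, is NOT decided here (the instance file's located check).
-/

namespace Summit.QuantumFields.BalabanUV.Beta.D1BFx.ColumnGaugeGenerator

open Literature.MathematicalPhysics.QuantumFieldTheory
open Literature.MathematicalPhysics.QuantumFieldTheory.Balaban1983to89
open Literature.MathematicalPhysics.QuantumFieldTheory.Balaban1983to89.Beta
open ExpKernelCalculus (MKer comp)
open OneStepResolventKernel (Fib wsum)
open KernelWard (divV)
open Summit.QuantumFields.BalabanUV.Beta.ChartConjugation (conjV)
open Summit.QuantumFields.BalabanUV.Beta.BorderedHessian (diagK diagK_apply conjV_diagK_apply comp_axEc_diagK_comm)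
open Summit.QuantumFields.BalabanUV.Beta.AxialDressingRooted (axEc tsum_point)
open Summit.QuantumFields.BalabanUV.Beta.AveragingWardRootedStencils (legSite legInd legInd_apply)
open AffineAveraging (box toSite)
open StepJetData (wilsonA)
open Summit.QuantumFields.BalabanUV.Beta.BorderedHessian (bhKAt)
open Summit.QuantumFields.BalabanUV.Beta.SpineRooted (S0NAt)
open Summit.QuantumFields.BalabanUV.Beta.WardLocusStencils (ffK conjV_bhKAt_diagK_legInd)
open Summit.QuantumFields.BalabanUV.Beta.WardLocusS0N (divV_S0NAt)
open Summit.QuantumFields.BalabanUV.Beta.WilsonDivergenceContact (divV_wilsonA_eq_conjV)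

noncomputable section

variable {d : ℕ}

/-! ## §1 The superposed generator is one diagonal kernel -/

/-- [folklore] A `χ`-weighted single-point sum: `Σ'_u χ u · [p = u] · c = χ p · c`. -/
theorem tsum_mul_ite_eq (χ : (Fin (d + 1) → ℤ) → ℝ) (p : Fin (d + 1) → ℤ) (c : ℝ) :
    ∑' u, χ u * ((if p = u then (1 : ℝ) else 0) * c) = χ p * c := by
  rw [← tsum_point p (fun u => χ u * c)]
  refine tsum_congr fun u => ?_
  by_cases h : p = u
  · rw [if_pos h, if_pos h, one_mul]
  · rw [if_neg h, if_neg h, zero_mul, mul_zero]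

/-- [folklore] **THE SUPERPOSED GENERATOR**: `wsum χ (u ↦ diagK (legInd ρ u)) = diagK (z b ↦ χ (legSite ρ z b))` — each leg `(z, b)` is acted on by the generator
of exactly one varied site, `u = legSite ρ z b`. -/
theorem wsum_diagK_legInd (χ : (Fin (d + 1) → ℤ) → ℝ) (ρ : Fin (d + 1) → ℤ) :
    wsum χ (fun u => diagK (legInd ρ u)) = diagK (fun z b => χ (legSite ρ z b)) := by
  funext x z a b
  simp only [wsum, diagK_apply, legInd]
  by_cases h : x = z ∧ a = b
  · simp only [if_pos h]
    have e := tsum_mul_ite_eq χ (legSite ρ x a) 1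
    simp only [mul_one] at e
    exact e
  · simp only [if_neg h, mul_zero, tsum_zero]

/-! ## §2 Superposing `conjV`-shaped slot letters gives the commutator with the superposed generator -/

/-- [folklore] **SUPERPOSITION OF DIAGONAL CONTACTS**: `wsum χ (u ↦ conjV M (diagK (legInd ρ u))) = conjV M (diagK (z b ↦ χ (legSite ρ z b)))` (entrywise:
`Σ'_u χ u · M x z a b · ([legSite ρ z b = u] − [legSite ρ x a = u]) = M x z a b · (χ (legSite ρ z b) − χ (legSite ρ x a))`; no summability needed). -/
theorem wsum_conjV_diagK_legInd (M : MKer (d + 1) (Fib d)) (χ : (Fin (d + 1) → ℤ) → ℝ) (ρ : Fin (d + 1) → ℤ) :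
    wsum χ (fun u => conjV M (diagK (legInd ρ u))) = conjV M (diagK (fun z b => χ (legSite ρ z b))) := by
  funext x z a b
  simp only [wsum, conjV_diagK_apply, legInd]
  have h1 : Summable fun u => χ u * ((if legSite ρ z b = u then (1 : ℝ) else 0) * M x z a b) := by
    refine summable_of_ne_finset_zero (s := {legSite ρ z b}) fun u hu => ?_
    rw [Finset.mem_singleton] at hu
    rw [if_neg (Ne.symm hu), zero_mul, mul_zero]
  have h2 : Summable fun u => χ u * ((if legSite ρ x a = u then (1 : ℝ) else 0) * M x z a b) := by
    refine summable_of_ne_finset_zero (s := {legSite ρ x a}) fun u hu => ?_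
    rw [Finset.mem_singleton] at hu
    rw [if_neg (Ne.symm hu), zero_mul, mul_zero]
  have e : ∀ u, χ u * (M x z a b * ((if legSite ρ z b = u then (1 : ℝ) else 0) - (if legSite ρ x a = u then (1 : ℝ) else 0)))
      = χ u * ((if legSite ρ z b = u then (1 : ℝ) else 0) * M x z a b) - χ u * ((if legSite ρ x a = u then (1 : ℝ) else 0) * M x z a b) :=
    fun u => by ring
  rw [tsum_congr e, h1.tsum_sub h2, tsum_mul_ite_eq, tsum_mul_ite_eq]
  ring

/-- [folklore] **FROM SLOT LETTERS TO THE COLUMN-GAUGE COMMUTATOR**: if a first-order family obeys, at every varied site `u`, the rooted slot Ward letter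
`divV S u = conjV 𝕄 (diagK (legInd ρ u))` (an1's shape), then for every weight `χ`
`wsum χ (u ↦ divV S u) = comp 𝕄 Λ − comp Λ 𝕄` with `Λ := diagK (z b ↦ χ (legSite ρ z b))` — so leaf-01's `V^{bm} = V − wsum χ (divV S)` reads
`V^{bm} = V + (Λ∘𝕄 − 𝕄∘Λ)`, the `G` of `ColumnGaugeInvariance.hessKer_columnGauge_of_relInv`. -/
theorem wsum_divV_eq_conjV_of_letters {S : Fin (d + 1) → (Fin (d + 1) → ℤ) → MKer (d + 1) (Fib d)} {M : MKer (d + 1) (Fib d)}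
    {ρ : Fin (d + 1) → ℤ} (hS : ∀ u, divV S u = conjV M (diagK (legInd ρ u))) (χ : (Fin (d + 1) → ℤ) → ℝ) :
    wsum χ (fun u => divV S u) = comp M (diagK (fun z b => χ (legSite ρ z b))) - comp (diagK (fun z b => χ (legSite ρ z b))) M := by
  simp only [hS]
  exact wsum_conjV_diagK_legInd M χ ρ


/-- [folklore] Scaling a diagonal contact: `ξ • conjV M (diagK g) = conjV M (diagK (ξ • g))`. -/
theorem smul_conjV_diagK (ξ : ℝ) (M : MKer (d + 1) (Fib d)) (g : (Fin (d + 1) → ℤ) → Fib d → ℝ) :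
    ξ • conjV M (diagK g) = conjV M (diagK (ξ • g)) := by
  funext x z a b
  simp only [Pi.smul_apply, smul_eq_mul, conjV_diagK_apply]
  ring

/-- [folklore] **THE SAME WITH A SCALAR LOCK** (the tree's level-0 shape: `WilsonDivergenceContact.divV_wilsonA_eq_conjV` carries `cE′ = ½`,
`WardLocusS0N.hSd_S0NAt_of_wilsonWard` the lock `ξ`): if `divV S u = ξ • conjV 𝕄 (diagK (legInd ρ u))` for every `u`, then
`wsum χ (u ↦ divV S u) = comp 𝕄 Λ − comp Λ 𝕄` with `Λ := diagK (z b ↦ ξ · χ (legSite ρ z b))`. -/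
theorem wsum_divV_eq_conjV_of_letters_smul {S : Fin (d + 1) → (Fin (d + 1) → ℤ) → MKer (d + 1) (Fib d)} {M : MKer (d + 1) (Fib d)}
    {ρ : Fin (d + 1) → ℤ} {ξ : ℝ} (hS : ∀ u, divV S u = ξ • conjV M (diagK (legInd ρ u))) (χ : (Fin (d + 1) → ℤ) → ℝ) :
    wsum χ (fun u => divV S u)
      = comp M (diagK (fun z b => ξ * χ (legSite ρ z b))) - comp (diagK (fun z b => ξ * χ (legSite ρ z b))) M := by
  have h : wsum χ (fun u => divV S u) = wsum (fun u => χ u * ξ) (fun u => conjV M (diagK (legInd ρ u))) := by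
    funext x z a b
    simp only [wsum, hS, Pi.smul_apply, smul_eq_mul]
    exact tsum_congr fun u => by ring
  rw [h, wsum_conjV_diagK_legInd]
  have eχ : (fun z b => (fun u => χ u * ξ) (legSite ρ z b)) = fun z b => ξ * χ (legSite ρ z b) := by
    funext z b; exact mul_comm _ _
  rw [eχ]
  rfl

/-- [folklore] The sign bookkeeping for the consumer: `V − wsum χ (divV S) = V + (Λ∘𝕄 − 𝕄∘Λ)`. -/
theorem sub_wsum_divV_eq_add_comm_of_letters {S : Fin (d + 1) → (Fin (d + 1) → ℤ) → MKer (d + 1) (Fib d)} {M : MKer (d + 1) (Fib d)}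
    {ρ : Fin (d + 1) → ℤ} (hS : ∀ u, divV S u = conjV M (diagK (legInd ρ u))) (χ : (Fin (d + 1) → ℤ) → ℝ) (V : MKer (d + 1) (Fib d)) :
    V - wsum χ (fun u => divV S u)
      = V + (comp (diagK (fun z b => χ (legSite ρ z b))) M - comp M (diagK (fun z b => χ (legSite ρ z b)))) := by
  rw [wsum_divV_eq_conjV_of_letters hS χ]
  abel

/-! ## §3 The generator commutes with the axial coordinate projector (letter `Λ∘E = E∘Λ` for `E := axEc ρ N`) -/

/-- [folklore] `comp Λ (axEc ρ N) = comp (axEc ρ N) Λ` for the diagonal generator `Λ = diagK g` (`DiagonalContact.comp_axEc_diagK_comm`, re-oriented for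
`ColumnGaugeInvariance.sandwich_of_relInv`'s `hΛE`). -/
theorem comp_generator_axEc_comm (g : (Fin (d + 1) → ℤ) → Fib d → ℝ) (ρ : Fin (d + 1) → ℤ) (N : ℕ) :
    comp (diagK g) (axEc ρ N) = comp (axEc ρ N) (diagK g) :=
  (comp_axEc_diagK_comm g ρ N).symm


/-! ## §4 The native spine's POINTWISE slot letter at level 0 (the tree's letters, termwise) and its column-gauge word -/

/-- **THE POINTWISE SLOT WARD LETTER OF THE NATIVE SPINE AT LEVEL 0** [our object]: on the hR normalisation hyperplane `2·cVH = −cE·Lc^{d+1}`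
(`KernelWardLevelsWilson.lock_zero_of_hyperplane`; the road's pins `(cE, cVH) = (n⁴, −n⁸∕2)` at `d + 1 = 4` lie on it), for an in-block root and every varied site `u`,
`divV (S0NAt d Lc ρ cE cVH cΛ) u = (cE∕2) • conjV (bhKAt d ρ Lc) (diagK (legInd ρ u))` — the termwise content of `WardLocusS0N.hSd_defect_S0NAt`:
`divV_S0NAt` (Λ-sector null) + `WilsonDivergenceContact.divV_wilsonA_eq_conjV` (`cE′ = ½`, unconditional) + `WardLocusStencils.conjV_bhKAt_diagK_legInd`. -/
theorem divV_S0NAt_eq_smul_conjV {Lc : ℕ} [NeZero Lc] (hLc : 1 ≤ Lc) {r : Fin (d + 1) → ℕ} (hr : r ∈ box (d + 1) Lc) {cE cVH : ℝ} (cΛ : ℝ)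
    (hn : 2 * cVH = -(cE * (Lc : ℝ) ^ (d + 1))) (u : Fin (d + 1) → ℤ) :
    divV (S0NAt d Lc (toSite r) cE cVH cΛ) u = (cE / 2) • conjV (bhKAt d (toSite r) Lc) (diagK (legInd (toSite r) u)) := by
  rw [divV_S0NAt hLc hr cE cVH cΛ u, conjV_bhKAt_diagK_legInd (toSite r) Lc hLc u, divV_wilsonA_eq_conjV (toSite r) Lc u,
    smul_sub, smul_smul, smul_smul]
  have hc : cVH = -(cE / 2 * (Lc : ℝ) ^ (d + 1)) := by linarith
  rw [hc, neg_smul, ← sub_eq_add_neg, show cE * (1 / 2 : ℝ) = cE / 2 from by ring]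

/-- **THE COLUMN-GAUGE WORD OF THE NATIVE SPINE AT LEVEL 0** [our object]: for every weight `χ`, on the hyperplane,
`wsum χ (u ↦ divV (S0NAt d Lc ρ cE cVH cΛ) u) = comp (bhKAt d ρ Lc) Λ − comp Λ (bhKAt d ρ Lc)`, `Λ := diagK (z b ↦ (cE∕2)·χ (legSite ρ z b))` — with leaf-01's
`DressedVertexSplit.vertexOfK_coDressKBmAt_eq_sub` the bm-dressed vertex of the native spine is `V + (Λ∘𝕄₀ − 𝕄₀∘Λ)`, `𝕄₀ = bhKAt`, the road's `RelInv` partner of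
`G₀^{bm}` (`BorderedHessianRooted.relInv_coDressKBmAt_KInvStep_zero_bhKAt`), `Λ∘axEc = axEc∘Λ` by §3 — i.e. every first-order letter of
`ColumnGaugeInvariance.hessKer_columnGauge_of_relInv` for the native spine at level 0, BY NAME. -/
theorem wsum_divV_S0NAt_eq_comm {Lc : ℕ} [NeZero Lc] (hLc : 1 ≤ Lc) {r : Fin (d + 1) → ℕ} (hr : r ∈ box (d + 1) Lc) {cE cVH : ℝ} (cΛ : ℝ)
    (hn : 2 * cVH = -(cE * (Lc : ℝ) ^ (d + 1))) (χ : (Fin (d + 1) → ℤ) → ℝ) :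
    wsum χ (fun u => divV (S0NAt d Lc (toSite r) cE cVH cΛ) u)
      = comp (bhKAt d (toSite r) Lc) (diagK (fun z b => cE / 2 * χ (legSite (toSite r) z b)))
        - comp (diagK (fun z b => cE / 2 * χ (legSite (toSite r) z b))) (bhKAt d (toSite r) Lc) :=
  wsum_divV_eq_conjV_of_letters_smul (fun u => divV_S0NAt_eq_smul_conjV hLc hr cΛ hn u) χ

end

end Summit.QuantumFields.BalabanUV.Beta.D1BFx.ColumnGaugeGenerator
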